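import Literature.NumberTheory.GaloisRepresentations.AbsGaloisGroupProofs
import HarnessLib

/-!
# Outer Galois conjugation: an automorphism of `F̄` preserving `F` acts on `Γ_F` and is conjugate, on `K̄₀ ⊆ F̄`, to an element of `Γ_{K₀}`

Topic `Literature/NumberTheory/GaloisRepresentations`; namespace `Literature.NumberTheory.GaloisRepresentations`. THEOREMS ONLY
(no definition, no named fact, no instance, no `sorry`). Companion of `AbsGaloisGroupProofs` (`exists_absClosureEmbedding_comp_eq`:
two `K`-embeddings `K̄ → L̄` differ by an element of `Γ_K`) and of `RestrictConjugateIso` (conjugate restrictions).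

For a tower of fields `K₀ ⊆ F` and a `K₀`-automorphism `ĝ` of `F̄ = AlgebraicClosure F` mapping `F` onto itself (`ĝ|_F = g`):
* `exists_algEquiv_lift` — every `g ∈ Aut(F/F₀)` with `F/F₀` algebraic HAS such a lift `ĝ : F̄ ≃ₐ[K₀] F̄` (`K₀ ⊆ F₀ ⊆ F`; Mathlib
  `AlgEquiv.liftNormal`, `F̄/F₀` being normal);
* `exists_outerEmb` — there is `τ ∈ Γ_{K₀}` with `j_F(τ x) = ĝ(j_F x)` on `K̄₀` (`j_F = absClosureEmbedding K₀ F`);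
* `exists_continuousMulEquiv_outerConj` — the OUTER CONJUGATION `α : Γ_F ≃ₜ* Γ_F`, `α σ = ĝ σ ĝ⁻¹` (`α σ • ĝ x = ĝ (σ • x)`), a
  homeomorphic group automorphism for the Krull topology;
* `outerConj_symm_smul`, ★ `absGaloisRestrict_eq_conj_of_outer` — `res_{F/K₀}(σ) = τ · res_{F/K₀}(α⁻¹ σ) · τ⁻¹`: the pair
  `(α⁻¹, T(τ))` is a compatible pair for every representation `T` of `Γ_{K₀}` restricted to `Γ_F` (Serre, *Galois Cohomology* I §2.4),
  so «pull back along `α⁻¹`, apply `T(τ)`» is the conjugation action of `ĝ` on `H^*(Γ_F, T|_{Γ_F})`.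

Use: Galois equivariance of the local Tate pairing / of `exp*` / of Kato's reciprocity law under `Gal(F/F₀)` (crux K★
`stmt-BirchSwinnertonDyer-22226`, G5 by Galois descent; `EllipticCurves/LocalTatePairingOuterGalois`). BSD is not advanced by this file.

## References
* J.-P. Serre, *Galois Cohomology* (1997), I §2.4 (compatible pairs), I §5.8. [SerreGaloisCohomology1997]
* J. Neukirch, A. Schmidt, K. Wingberg, *Cohomology of Number Fields* (2008), I §5 (conjugation on cohomology). [NeukirchSchmidtWingberg2008]
* J. S. Milne, *Fields and Galois Theory* (2022), Ch. 7 (Krull topology; the absolute Galois group up to inner automorphism). [MilneFT2022]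
-/

noncomputable section

open Field Function

namespace Literature.NumberTheory.GaloisRepresentations

variable {K₀ : Type} [Field K₀] (F : Type) [Field F] [Algebra K₀ F]

/-! ### §0 Lifting an automorphism of `F` to `F̄` -/

/-- **Every `g ∈ Aut(F/F₀)` lifts to a `K₀`-automorphism of `F̄` preserving `F`** (`K₀ ⊆ F₀ ⊆ F`, `F/F₀` algebraic): `F̄` is an
algebraic closure of `F₀`, hence normal over `F₀`, and Mathlib's `AlgEquiv.liftNormal` extends `g`.
[cite: MilneFT2022, Ch. 7 (extension of automorphisms to the algebraic closure)] -/
theorem exists_algEquiv_lift (F₀ : Type) [Field F₀] [Algebra K₀ F₀] [Algebra F₀ F] [IsScalarTower K₀ F₀ F]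
    [Algebra.IsAlgebraic F₀ F] (g : F ≃ₐ[F₀] F) :
    ∃ ĝ : AlgebraicClosure F ≃ₐ[K₀] AlgebraicClosure F,
      ∀ c : F, ĝ (algebraMap F (AlgebraicClosure F) c) = algebraMap F (AlgebraicClosure F) (g c) := by
  haveI : Algebra.IsAlgebraic F₀ (AlgebraicClosure F) := Algebra.IsAlgebraic.trans F₀ F (AlgebraicClosure F)
  haveI : IsAlgClosure F₀ (AlgebraicClosure F) := { isAlgClosed := inferInstance, isAlgebraic := inferInstance }
  exact ⟨(g.liftNormal (AlgebraicClosure F)).restrictScalars K₀, fun c => g.liftNormal_commutes (AlgebraicClosure F) c⟩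

/-! ### §1 The outer-conjugation datum `(ĝ, α, τ)` -/

section Datum

variable (ĝ : AlgebraicClosure F ≃ₐ[K₀] AlgebraicClosure F)

/-- **The element of `Γ_{K₀}` behind `ĝ`**: there is `τ ∈ Γ_{K₀}` with `j_F(τ x) = ĝ(j_F x)` for all `x ∈ K̄₀` (`j_F` the chosen
`K₀`-embedding `K̄₀ → F̄`): two `K₀`-embeddings `K̄₀ → F̄` differ by an element of `Γ_{K₀}` (tree `exists_absClosureEmbedding_comp_eq`).
[cite: MilneFT2022, Ch. 7, footnote after Prop. 7.6] -/
theorem exists_outerEmb :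
    ∃ τ : absoluteGaloisGroup K₀, ∀ x : AlgebraicClosure K₀,
      absClosureEmbedding K₀ F (τ • x) = ĝ (absClosureEmbedding K₀ F x) :=
  exists_absClosureEmbedding_comp_eq K₀ F ((ĝ : AlgebraicClosure F →ₐ[K₀] AlgebraicClosure F).comp (absClosureEmbedding K₀ F))

/-- **The outer conjugation `σ ↦ ĝ σ ĝ⁻¹` is a homeomorphic automorphism of `Γ_F`** when `ĝ` maps `F` into itself (`hĝ`): there is
`α : Γ_F ≃ₜ* Γ_F` with `α σ • ĝ x = ĝ (σ • x)`. Continuity: `α⁻¹(Gal(F̄/F(S))) ⊇ Gal(F̄/F(ĝ⁻¹ S))` for finite `S`.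
[cite: NeukirchSchmidtWingberg2008, I §5 (conjugation on cohomology)] [cite: MilneFT2022, Ch. 7 (Krull topology)] -/
theorem exists_continuousMulEquiv_outerConj (g : F ≃ₐ[K₀] F)
    (hĝ : ∀ c : F, ĝ (algebraMap F (AlgebraicClosure F) c) = algebraMap F (AlgebraicClosure F) (g c)) :
    ∃ α : absoluteGaloisGroup F ≃ₜ* absoluteGaloisGroup F,
      ∀ (σ : absoluteGaloisGroup F) (x : AlgebraicClosure F), α σ • ĝ x = ĝ (σ • x) := by
  have hĝs : ∀ c : F, ĝ.symm (algebraMap F (AlgebraicClosure F) c) = algebraMap F (AlgebraicClosure F) (g.symm c) := by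
    intro c
    apply ĝ.injective
    rw [AlgEquiv.apply_symm_apply, hĝ, AlgEquiv.apply_symm_apply]
  -- the conjugate of an `F`-automorphism by `ĝ` (resp. `ĝ⁻¹`) is an `F`-automorphism
  let fwd : absoluteGaloisGroup F → absoluteGaloisGroup F := fun σ => (absoluteGaloisGroup.toAlgEquiv F).symm
    (AlgEquiv.ofRingEquiv (f := (ĝ.symm.toRingEquiv.trans ((absoluteGaloisGroup.toAlgEquiv F σ).toRingEquiv.trans ĝ.toRingEquiv)))
      (fun c => by
        change ĝ (σ • (ĝ.symm (algebraMap F _ c))) = algebraMap F _ c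
        rw [hĝs, absoluteGaloisGroup.smul_def, AlgEquiv.commutes, hĝ, AlgEquiv.apply_symm_apply]))
  let bwd : absoluteGaloisGroup F → absoluteGaloisGroup F := fun σ => (absoluteGaloisGroup.toAlgEquiv F).symm
    (AlgEquiv.ofRingEquiv (f := (ĝ.toRingEquiv.trans ((absoluteGaloisGroup.toAlgEquiv F σ).toRingEquiv.trans ĝ.symm.toRingEquiv)))
      (fun c => by
        change ĝ.symm (σ • (ĝ (algebraMap F _ c))) = algebraMap F _ c
        rw [hĝ, absoluteGaloisGroup.smul_def, AlgEquiv.commutes, hĝs, AlgEquiv.symm_apply_apply]))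
  have hfwd : ∀ σ x, fwd σ • x = ĝ (σ • (ĝ.symm x)) := fun _ _ => rfl
  have hbwd : ∀ σ x, bwd σ • x = ĝ.symm (σ • (ĝ x)) := fun _ _ => rfl
  have heq : ∀ a b : absoluteGaloisGroup F, (∀ x : AlgebraicClosure F, a • x = b • x) → a = b := fun a b h =>
    FaithfulSMul.eq_of_smul_eq_smul (α := AlgebraicClosure F) h
  let α₀ : absoluteGaloisGroup F ≃* absoluteGaloisGroup F :=
    { toFun := fwd
      invFun := bwd
      left_inv := fun σ => heq _ _ fun x => by rw [hbwd, hfwd, AlgEquiv.symm_apply_apply, AlgEquiv.symm_apply_apply]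
      right_inv := fun σ => heq _ _ fun x => by rw [hfwd, hbwd, AlgEquiv.apply_symm_apply, AlgEquiv.apply_symm_apply]
      map_mul' := fun σ σ' => heq _ _ fun x => by
        rw [mul_smul, hfwd, hfwd, hfwd, mul_smul, AlgEquiv.symm_apply_apply] }
  -- continuity of a conjugation map `σ ↦ e σ e⁻¹` for `e ∈ {ĝ, ĝ⁻¹}`
  have hcont : ∀ (e : AlgebraicClosure F ≃ₐ[K₀] AlgebraicClosure F) (f : absoluteGaloisGroup F →* absoluteGaloisGroup F),
      (∀ σ x, f σ • x = e (σ • (e.symm x))) → Continuous f := by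
    intro e f hf
    apply continuous_of_continuousAt_one _ (continuousAt_def.mpr _)
    intro N hN
    rw [map_one] at hN
    obtain ⟨E, _, hE⟩ := (krullTopology_mem_nhds_one_iff F (AlgebraicClosure F) N).mp hN
    let b := Module.finBasis F E
    let S : Set (AlgebraicClosure F) := Set.range fun i => e.symm (b i)
    let E' : IntermediateField F (AlgebraicClosure F) := IntermediateField.adjoin F S
    haveI : FiniteDimensional F E' :=
      IntermediateField.finiteDimensional_adjoin fun x _ => Algebra.IsIntegral.isIntegral x
    refine (krullTopology_mem_nhds_one_iff F (AlgebraicClosure F) _).mpr ⟨E', inferInstance, fun σ hσ => hE ?_⟩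
    rw [SetLike.mem_coe, IntermediateField.mem_fixingSubgroup_iff] at hσ
    rw [SetLike.mem_coe, IntermediateField.mem_fixingSubgroup_iff]
    have hb : ∀ i, f σ • (b i : AlgebraicClosure F) = b i := by
      intro i
      rw [hf]
      exact (congrArg e (hσ _ (IntermediateField.subset_adjoin F S ⟨i, rfl⟩))).trans (e.apply_symm_apply _)
    have key : ((show AlgebraicClosure F ≃ₐ[F] AlgebraicClosure F from f σ).toLinearMap ∘ₗ E.val.toLinearMap) =
        E.val.toLinearMap :=
      b.ext fun i => hb i
    intro x hx
    exact congr($key ⟨x, hx⟩)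
  refine ⟨{ α₀ with
      continuous_toFun := hcont ĝ α₀.toMonoidHom hfwd
      continuous_invFun := hcont ĝ.symm α₀.symm.toMonoidHom (fun σ x => by
        change bwd σ • x = _
        rw [hbwd, AlgEquiv.symm_symm]) }, fun σ x => ?_⟩
  change fwd σ • (ĝ x) = ĝ (σ • x)
  rw [hfwd, AlgEquiv.symm_apply_apply]

variable {α : absoluteGaloisGroup F ≃ₜ* absoluteGaloisGroup F}
  (hα : ∀ (σ : absoluteGaloisGroup F) (x : AlgebraicClosure F), α σ • ĝ x = ĝ (σ • x))
  {τ : absoluteGaloisGroup K₀}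
  (hτ : ∀ x : AlgebraicClosure K₀, absClosureEmbedding K₀ F (τ • x) = ĝ (absClosureEmbedding K₀ F x))

include hα in
/-- `ĝ ((α⁻¹ σ) • x) = σ • ĝ x` (the compatible-pair relation read for `α⁻¹`). [cite: SerreGaloisCohomology1997, I §2.4 (compatible pairs)] -/
theorem outerConj_symm_smul (σ : absoluteGaloisGroup F) (x : AlgebraicClosure F) :
    ĝ ((α.symm σ) • x) = σ • ĝ x := by
  rw [← hα, ContinuousMulEquiv.apply_symm_apply]

include hα hτ in
/-- **The restriction map is conjugated by the outer datum**: `res_{F/K₀}(σ) = τ · res_{F/K₀}(α⁻¹ σ) · τ⁻¹` — both sides act on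
`x ∈ K̄₀` through `j_F`, `ĝ` and `σ` in the same way (`j_F(res σ' • x) = σ' • j_F x`, `j_F ∘ τ = ĝ ∘ j_F`, `α σ • ĝ x = ĝ(σ • x)`).
[cite: SerreGaloisCohomology1997, I §2.4 (compatible pairs)] [cite: MilneFT2022, Ch. 7, footnote after Prop. 7.6] -/
theorem absGaloisRestrict_eq_conj_of_outer (σ : absoluteGaloisGroup F) :
    absGaloisRestrict K₀ F σ =
      τ * ((absGaloisRestrict K₀ F).comp (α.symm : absoluteGaloisGroup F →ₜ* absoluteGaloisGroup F)) σ * τ⁻¹ := by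
  have hτ' : ∀ x : AlgebraicClosure K₀, absClosureEmbedding K₀ F (τ⁻¹ • x) = ĝ.symm (absClosureEmbedding K₀ F x) := by
    intro x
    apply ĝ.injective
    rw [← hτ, smul_inv_smul, AlgEquiv.apply_symm_apply]
  refine FaithfulSMul.eq_of_smul_eq_smul (α := AlgebraicClosure K₀) fun x => ?_
  apply (absClosureEmbedding K₀ F).toRingHom.injective
  change absClosureEmbedding K₀ F (absGaloisRestrict K₀ F σ • x) =
    absClosureEmbedding K₀ F ((τ * absGaloisRestrict K₀ F (α.symm σ) * τ⁻¹) • x)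
  rw [absGaloisRestrict_apply_smul, mul_smul, mul_smul, hτ, absGaloisRestrict_apply_smul, outerConj_symm_smul F ĝ hα, hτ',
    AlgEquiv.apply_symm_apply]

end Datum

end Literature.NumberTheory.GaloisRepresentations

end
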